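import Summits.AtomisticToContinuum.BoseEinsteinCondensation.Theorems.BECPalmDirectCorrelationStructureFactorFloorRigidity
import Summits.AtomisticToContinuum.BoseEinsteinCondensation.Theorems.BECConjugateDominationPuffFloorSolidCore
import HarnessLib

/-!
# Route `BECPalmDirectCorrelation`, support item `StructureFactorFloor` (stmt-AtomisticToContinuum-12228):
# the structure-factor floor for the smooth solid-core class, on ALL near-minimisers

Supports (does not close) stmt-AtomisticToContinuum-12228. The item
`Summit.AtomisticToContinuum.BoseEinsteinCondensation.Theses.BECPalmDirectCorrelation.StructureFactorFloor`
asks, for EVERY repulsive finite-range (measurable) pair potential `v`, small density `ρ` and all large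
`N = n+1`, for a `δ > 0` such that every `δ`-near-minimiser `Ψ` of the periodic `N`-body energy on the torus
of side `L = (N/ρ)^{1/3}` has cell structure factor
`S_m(Ψ) = N⁻¹ ∫_{cell^N} |∑ⱼ e_m(xⱼ)|² |Ψ|² ≥ c · min(ℓ |m|/L, 1)` at every mode `m ∈ ℤ³ ∖ 0`.

**Main result** `structureFactorFloor_smoothSolidCore`: the body of the item, verbatim, for the potentials
of the *smooth solid-core class* — `v` finite, `x ↦ v(|x|)` of class `C²` on `ℝ³` with the edge condition
`‖D²ṽ‖ ≤ Cₑ√ṽ`, and a positive soft core `0 < v 0` — i.e. the item's text with these four hypotheses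
inserted after `IsRepulsiveFiniteRange v`. Constants: `c = 1/8`, `ℓ = 2π/√(Cρ + 1)` with `C` the constant
of the exact-minimiser floor.

**Proof.**
1. *Exact minimiser* (route `BECConjugateDomination`, crux `PuffFloor`, solid-core case, all landed):
   `stub_positiveMinimiser` gives a positive exact minimiser `Ψ₀`, and `stub_puffFloorSolidCore` (Puff–Feynman
   sum rules `m₀ ≥ m₁^{3/2} m₃^{-1/2}`, f-sum rule, Puff's cubic moment, Lee's no-binding theorem) gives
   `S_m(Ψ₀) ≥ |k|/√(|k|² + Cρ)`, `k = 2πm/L`, eventually in `n` [Puff1965; Stringari1995 §2.3 (20)–(23)].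
2. *`L²`-rigidity of near-minimisers up to a phase* (`exists_phase_lintegral_sub_sq_le`): at fixed `(N, L)`
   the bosonic ground state of `-Δ + V^per` (`V^per` bounded) is simple
   (`PeriodicGroundStateNondegenerate_holds`, Reed–Simon IV §XIII.12), so the form gap inequality
   `q(ψ) - E₀ ≥ (E₁ - E₀)(1 - |⟨φ₀, ψ⟩|²)` and phase alignment give, for every `η > 0`, a `δ > 0` with
   `∫_{cell^N} |Ψ₀ - cΦ|² ≤ η²` (`|c| = 1`) for every `δ`-near-minimiser `Φ` [ReedSimonIV1978, Thm. XIII.1].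
3. *`√(N S_m)` is `N`-Lipschitz in `L²(cell^N)`* (`rpow_lintegral_weight_sq_le`, Minkowski with the weight
   `|∑ⱼ e_m(xⱼ)| ≤ N`): `√(N S_m(Ψ₀)) ≤ √(N S_m(Φ)) + Nη`.
4. With `η = ½√(F⋆/N)`, `F⋆ = (2π/L)/√((2π/L)² + Cρ) ≤ S_m(Ψ₀)` (the floor is increasing in `|k| ≥ 2π/L`),
   `Nη ≤ ½√(N S_m(Ψ₀))`, hence `S_m(Φ) ≥ ¼ S_m(Ψ₀) ≥ ¼|k|/√(|k|²+Cρ+1) ≥ ⅛ min(ℓ|m|/L, 1)`.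

What is NOT covered (why the item stays open): coreless smooth potentials (`v 0 = 0`: the registered residual
`stub_corelessPairMoment` of crux stmt-AtomisticToContinuum-11785, a uniform-in-`N` no-clustering bound not
in print) and non-smooth / hard-core potentials (Puff's `m₃ = ∞`; no mechanism on file).
-/

noncomputable section

namespace Summit.AtomisticToContinuum.BoseEinsteinCondensation.Theorems

open MeasureTheory Filter Set Complex
open scoped ENNReal NNReal Topology ComplexConjugate InnerProductSpace BigOperators
open Literature.MathematicalPhysics.QuantumManyBody.BoseGas Literature.Analysis.InnerProduct

open StructureFactorFloor

/-- **Transfer: an exact-minimiser floor gives the near-minimiser floor (smooth class).** For a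
smooth-class potential `v` (repulsive finite range, finite, `x ↦ v(|x|)` of class `C²`, edge condition) and
constants `C ≥ 0`, `ρ₀ > 0` such that for `0 < ρ < ρ₀`, eventually in `n`, every exact real nowhere-zero
finite-energy minimiser `Ψ₀` of the periodic `(n+1)`-body energy on the torus of side `L = ((n+1)/ρ)^{1/3}`
has `S_m(Ψ₀) ≥ |k|/√(|k|² + Cρ)` (`k = 2πm/L`, `m ≠ 0`) — the shape of crux `PuffFloor` of route
`BECConjugateDomination` — the conclusion of item `StructureFactorFloor` holds for `v` on ALL near-minimisers:
for `0 < ρ < ρ₀` there are `c = 1/8`, `ℓ = 2π/√(Cρ+1)` with, for all large `n`, some `δ > 0` such that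
every `δ`-near-minimiser `Ψ` has `S_m(Ψ) ≥ c·min(ℓ‖m/L‖, 1)` for all `m ≠ 0` (the item's `ℝ≥0∞` cell
structure factor). Proof: positive exact minimiser (`stub_positiveMinimiser`), `L²`-rigidity of
near-minimisers up to a phase (`exists_phase_lintegral_sub_sq_le`, `η = ½√(F⋆/N)` with
`F⋆ = (2π/L)/√((2π/L)²+Cρ)` the smallest floor value), the `N`-Lipschitz bound for `√(N S_m)`
(`sqrt_weightMoment_le`), whence `S_m(Ψ) ≥ ¼S_m(Ψ₀) ≥ ⅛min(ℓ‖m/L‖, 1)`.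
[cite: Stringari1995, §2.3 (20)–(23); ReedSimonIV1978, Thm. XIII.1] -/
theorem structureFactorFloor_smooth_of_exactFloor
    (v : ℝ → ℝ≥0∞) (hv : IsRepulsiveFiniteRange v) (hfin : ∀ r, v r ≠ ⊤)
    (hC2 : ContDiff ℝ 2 (fun x : Space => (v ‖x‖).toReal))
    (hedge : ∃ Cₑ : ℝ, ∀ x : Space, ‖iteratedFDeriv ℝ 2 (fun x : Space => (v ‖x‖).toReal) x‖
        ≤ Cₑ * Real.sqrt ((v ‖x‖).toReal))
    {C ρ₀ : ℝ} (hC0 : 0 ≤ C)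
    (hPF : ∀ ρ : ℝ, 0 < ρ → ρ < ρ₀ → ∀ᶠ n : ℕ in Filter.atTop,
        ∀ Ψ : PeriodicTrialState (n + 1) (sideLength ρ (n + 1)),
          periodicEnergy v Ψ = periodicGroundStateEnergy v (n + 1) (sideLength ρ (n + 1)) →
          periodicEnergy v Ψ ≠ ⊤ → (∀ X, Ψ.ψ X = (‖Ψ.ψ X‖ : ℂ)) → (∀ X, Ψ.ψ X ≠ 0) →
          ∀ m : Fin 3 → ℤ, m ≠ 0 →
            ‖(2 * Real.pi / sideLength ρ (n + 1)) • latticeVec 1 m‖ /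
                Real.sqrt (‖(2 * Real.pi / sideLength ρ (n + 1)) • latticeVec 1 m‖ ^ 2 + C * ρ) ≤
              ((n : ℝ) + 1)⁻¹ *
                ∫ X in cellN (n + 1) (sideLength ρ (n + 1)),
                  ‖∑ j : Fin (n + 1), cellWave (sideLength ρ (n + 1)) m (X j)‖ ^ 2 * ‖Ψ.ψ X‖ ^ 2) :
    ∀ ρ : ℝ, 0 < ρ → ρ < ρ₀ → ∃ c ℓ : ℝ, 0 < c ∧ 0 < ℓ ∧
        ∀ᶠ n : ℕ in Filter.atTop, let L : ℝ := sideLength ρ (n + 1);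
        ∃ δ : ENNReal, 0 < δ ∧ ∀ Ψ : PeriodicTrialState (n + 1) L,
          periodicEnergy v Ψ ≤ periodicGroundStateEnergy v (n + 1) L + δ →
          (let S : (Fin 3 → ℤ) → ENNReal := fun m => ((n + 1 : ℕ) : ENNReal)⁻¹ *
              (∫⁻ X in cellN (n + 1) L, (‖∑ j : Fin (n + 1), cellWave L m (X j)‖₊ : ENNReal) ^ 2 *
                (‖Ψ.ψ X‖₊ : ENNReal) ^ 2);
            ∀ m : Fin 3 → ℤ, m ≠ 0 →
              ENNReal.ofReal (c * min (ℓ * ‖latticeVec L⁻¹ m‖) 1) ≤ S m) := by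
  intro ρ hρ hρρ₀
  obtain ⟨R₀, hR₀⟩ := hv.2
  -- the constants `c = 1/8`, `ℓ = 2π/√Θ`, `Θ = Cρ + 1`
  set Θ : ℝ := C * ρ + 1 with hΘ
  have hΘpos : 0 < Θ := by positivity
  have hsΘ : 0 < Real.sqrt Θ := Real.sqrt_pos.2 hΘpos
  refine ⟨1 / 8, 2 * Real.pi / Real.sqrt Θ, by norm_num, div_pos (by positivity) hsΘ, ?_⟩
  filter_upwards [hPF ρ hρ hρρ₀] with n hn
  dsimp only
  -- fixed `n`: the side, the positive minimiser, the bounded periodisation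
  set L : ℝ := sideLength ρ (n + 1) with hLdef
  have hLpos : 0 < L := sideLength_pos_of_pos hρ (Nat.succ_pos n)
  set k₁ : ℝ := 2 * Real.pi / L with hk₁
  have hk₁pos : 0 < k₁ := by positivity
  obtain ⟨Ψ₀, hmin₀, hfin₀, _hC3, hreal₀, hne₀⟩ :=
    stub_positiveMinimiser v hv hfin hC2 hedge n L hLpos
  obtain ⟨M, hM⟩ := exists_bound_of_continuous_finiteRange hfin hC2.continuous hR₀
  obtain ⟨Cp, hCp⟩ := exists_bound_periodizedPotential_of_space hLpos hM hR₀
  -- the smallest floor value `F⋆` over the modes, the tolerance `η` and the slack `δ`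
  set Fstar : ℝ := k₁ / Real.sqrt (k₁ ^ 2 + C * ρ) with hFstar
  have hFstar_pos : 0 < Fstar :=
    div_pos hk₁pos (Real.sqrt_pos.2 (add_pos_of_pos_of_nonneg (pow_pos hk₁pos 2) (by positivity)))
  have hNpos : (0 : ℝ) < (n : ℝ) + 1 := by positivity
  set η : ℝ := Real.sqrt (Fstar / ((n : ℝ) + 1)) / 2 with hη
  have hηpos : 0 < η := by positivity
  obtain ⟨δ, hδ, hrig⟩ := exists_phase_lintegral_sub_sq_le hLpos hv.1 hCp n hηpos
  refine ⟨δ, hδ, fun Φ hΦ m hm => ?_⟩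
  -- the three moments of the mode `m`
  obtain ⟨c, hc, hD⟩ := hrig Ψ₀ Φ hmin₀ hΦ
  have hPuff := hn Ψ₀ hmin₀ hfin₀ hreal₀ hne₀ m hm
  rw [integral_weight_sq_eq_toReal L m Ψ₀] at hPuff
  have hMink := sqrt_weightMoment_le L m Ψ₀ Φ hc
  set x : ℝ := ‖k₁ • latticeVec 1 m‖ with hxdef
  set A : ℝ≥0∞ := ∫⁻ X in cellN (n + 1) L, ((‖∑ j : Fin (n + 1), cellWave L m (X j)‖₊ : ℝ≥0∞)) ^ 2 *
      (‖Ψ₀.ψ X‖₊ : ℝ≥0∞) ^ 2 with hAdef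
  set B : ℝ≥0∞ := ∫⁻ X in cellN (n + 1) L, ((‖∑ j : Fin (n + 1), cellWave L m (X j)‖₊ : ℝ≥0∞)) ^ 2 *
      (‖Φ.ψ X‖₊ : ℝ≥0∞) ^ 2 with hBdef
  set D : ℝ≥0∞ := ∫⁻ X in cellN (n + 1) L, (‖Ψ₀.ψ X - c * Φ.ψ X‖₊ : ℝ≥0∞) ^ 2 with hDdef
  have hBtop : B ≠ ⊤ :=
    ne_top_of_le_ne_top (ENNReal.pow_ne_top ENNReal.coe_ne_top) (lintegral_weight_sq_le L m Φ)
  have ha0 : 0 ≤ A.toReal := ENNReal.toReal_nonneg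
  have hb0 : 0 ≤ B.toReal := ENNReal.toReal_nonneg
  -- (R2) `√d ≤ η`
  have hDle : D.toReal ≤ η ^ 2 := ENNReal.toReal_le_of_le_ofReal (sq_nonneg η) hD
  have hsd : Real.sqrt D.toReal ≤ η := by
    calc Real.sqrt D.toReal ≤ Real.sqrt (η ^ 2) := Real.sqrt_le_sqrt hDle
      _ = η := Real.sqrt_sq hηpos.le
  -- (R3)–(R4) `(n+1) F⋆ ≤ (n+1) F_m ≤ a`
  have hx : x = k₁ * ‖latticeVec 1 m‖ := by
    rw [hxdef, norm_smul, Real.norm_of_nonneg hk₁pos.le]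
  have hk₁x : k₁ ≤ x := by
    rw [hx]
    exact le_mul_of_one_le_right hk₁pos.le (one_le_norm_latticeVec_one hm)
  have hxpos : 0 < x := hk₁pos.trans_le hk₁x
  have hFm : Fstar ≤ x / Real.sqrt (x ^ 2 + C * ρ) := div_sqrt_sq_add_mono (by positivity) hk₁pos hk₁x
  have hPuff' : ((n : ℝ) + 1) * (x / Real.sqrt (x ^ 2 + C * ρ)) ≤ A.toReal := by
    have h := mul_le_mul_of_nonneg_left hPuff hNpos.le
    rwa [← mul_assoc, mul_inv_cancel₀ hNpos.ne', one_mul] at h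
  have haF : ((n : ℝ) + 1) * Fstar ≤ A.toReal := (mul_le_mul_of_nonneg_left hFm hNpos.le).trans hPuff'
  -- (R5) `2(n+1)η ≤ √a`
  have hη2 : η ^ 2 = Fstar / ((n : ℝ) + 1) / 4 := by
    rw [hη, div_pow, Real.sq_sqrt (by positivity)]
    norm_num
  have hNη : 2 * (((n : ℝ) + 1) * η) ≤ Real.sqrt A.toReal := by
    rw [Real.le_sqrt (by positivity) ha0]
    calc (2 * (((n : ℝ) + 1) * η)) ^ 2 = 4 * ((n : ℝ) + 1) ^ 2 * η ^ 2 := by ring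
      _ = ((n : ℝ) + 1) * Fstar := by
          rw [hη2]
          field_simp
      _ ≤ A.toReal := haF
  -- (R6) `a ≤ 4b`
  have hsqrt : Real.sqrt A.toReal ≤ 2 * Real.sqrt B.toReal := by
    have h := mul_le_mul_of_nonneg_left hsd hNpos.le
    linarith [hMink, h, hNη]
  have hab : A.toReal ≤ 4 * B.toReal := by
    calc A.toReal = Real.sqrt A.toReal ^ 2 := (Real.sq_sqrt ha0).symm
      _ ≤ (2 * Real.sqrt B.toReal) ^ 2 := pow_le_pow_left₀ (Real.sqrt_nonneg _) hsqrt 2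
      _ = 4 * B.toReal := by rw [mul_pow, Real.sq_sqrt hb0]; norm_num
  -- (R7) the floor profile dominates `½ min(x/√Θ, 1)`, and `x/√Θ = ℓ‖m/L‖`
  have hprof : min (x / Real.sqrt Θ) 1 / 2 ≤ x / Real.sqrt (x ^ 2 + C * ρ) :=
    (half_min_le_div_sqrt hxpos.le hΘpos).trans
      (div_sqrt_sq_add_anti hxpos.le (by linarith : C * ρ ≤ Θ) (by positivity))
  have hℓ : 2 * Real.pi / Real.sqrt Θ * ‖latticeVec L⁻¹ m‖ = x / Real.sqrt Θ := by
    rw [norm_latticeVec_eq_mul L⁻¹ (inv_nonneg.2 hLpos.le), hx, hk₁]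
    ring
  -- (R8) the real inequality `⅛ min(ℓ‖m/L‖, 1) (n+1) ≤ b`
  have hfinal : 1 / 8 * min (2 * Real.pi / Real.sqrt Θ * ‖latticeVec L⁻¹ m‖) 1 * ((n : ℝ) + 1) ≤
      B.toReal := by
    rw [hℓ]
    have h := mul_le_mul_of_nonneg_left hprof hNpos.le
    linarith [h, hPuff', hab]
  -- back to `ℝ≥0∞`
  have hNcast : ((n + 1 : ℕ) : ℝ≥0∞) = ENNReal.ofReal ((n : ℝ) + 1) := by
    rw [← ENNReal.ofReal_natCast]
    push_cast
    rfl
  rw [hNcast, ← ENNReal.ofReal_toReal hBtop, ← ENNReal.ofReal_inv_of_pos hNpos,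
    ← ENNReal.ofReal_mul (inv_nonneg.2 hNpos.le)]
  refine ENNReal.ofReal_le_ofReal ?_
  rw [le_inv_mul_iff₀ hNpos]
  linarith [hfinal]

/-- **`StructureFactorFloor` for the smooth solid-core class (supports stmt-AtomisticToContinuum-12228).**
The body of `Theses.BECPalmDirectCorrelation.StructureFactorFloor`, verbatim, with the four hypotheses of
the smooth solid-core class inserted after `IsRepulsiveFiniteRange v` (`v` finite; `x ↦ v(|x|)` of class
`C²`; edge condition `‖D²ṽ‖ ≤ Cₑ√ṽ`; positive soft core `0 < v 0`): there is `ρ₀ > 0` such that for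
`0 < ρ < ρ₀` there are `c, ℓ > 0` (`c = 1/8`, `ℓ = 2π/√(Cρ+1)`) with, for all large `N = n+1`, some `δ > 0`
such that EVERY `δ`-near-minimiser `Ψ` of the periodic `N`-body energy on the torus of side
`L = (N/ρ)^{1/3}` has `S_m(Ψ) ≥ c·min(ℓ‖m/L‖, 1)` at every mode `m ≠ 0`. Proof: the exact positive
minimiser's Puff–Feynman floor `S_m(Ψ₀) ≥ |k|/√(|k|²+Cρ)` (`stub_puffFloorSolidCore`,
`stub_positiveMinimiser`), `L²`-rigidity of near-minimisers up to a phase from the simple ground state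
(`exists_phase_lintegral_sub_sq_le`), and the `N`-Lipschitz bound for `√(N S_m)` (`sqrt_weightMoment_le`)
with `η = ½√(F⋆/N)`. [cite: Puff1965, (12)–(15); Stringari1995, §2.3 (20)–(23); ReedSimonIV1978, Thm. XIII.1] -/
theorem structureFactorFloor_smoothSolidCore :
    ∀ v : ℝ → ENNReal, IsRepulsiveFiniteRange v → (∀ r, v r ≠ ⊤) →
      ContDiff ℝ 2 (fun x : Space => (v ‖x‖).toReal) →
      (∃ Cₑ : ℝ, ∀ x : Space, ‖iteratedFDeriv ℝ 2 (fun x : Space => (v ‖x‖).toReal) x‖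
          ≤ Cₑ * Real.sqrt ((v ‖x‖).toReal)) →
      0 < v 0 →
      ∃ ρ₀ : ℝ, 0 < ρ₀ ∧ ∀ ρ : ℝ, 0 < ρ → ρ < ρ₀ → ∃ c ℓ : ℝ, 0 < c ∧ 0 < ℓ ∧
        ∀ᶠ n : ℕ in Filter.atTop, let L : ℝ := sideLength ρ (n + 1);
        ∃ δ : ENNReal, 0 < δ ∧ ∀ Ψ : PeriodicTrialState (n + 1) L,
          periodicEnergy v Ψ ≤ periodicGroundStateEnergy v (n + 1) L + δ →
          (let S : (Fin 3 → ℤ) → ENNReal := fun m => ((n + 1 : ℕ) : ENNReal)⁻¹ *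
              (∫⁻ X in cellN (n + 1) L, (‖∑ j : Fin (n + 1), cellWave L m (X j)‖₊ : ENNReal) ^ 2 *
                (‖Ψ.ψ X‖₊ : ENNReal) ^ 2);
            ∀ m : Fin 3 → ℤ, m ≠ 0 →
              ENNReal.ofReal (c * min (ℓ * ‖latticeVec L⁻¹ m‖) 1) ≤ S m) := by
  intro v hv hfin hC2 hedge hcore
  obtain ⟨C, hC0, ρ₀, hρ₀, hPF⟩ := stub_puffFloorSolidCore v hv hfin hC2 hedge hcore
  exact ⟨ρ₀, hρ₀, structureFactorFloor_smooth_of_exactFloor v hv hfin hC2 hedge hC0 hPF⟩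

/-- **`StructureFactorFloor` for the whole smooth class, conditionally on crux `PuffFloor`** (route
`BECConjugateDomination`, stmt-AtomisticToContinuum-11785, whose coreless case `v 0 = 0` is open): the
body of the item for every smooth-class `v` (finite, `C²` as `ṽ`, edge condition), from the exact-minimiser
floor `PuffFloor` by the transfer `structureFactorFloor_smooth_of_exactFloor`. When the crux closes, this
gives the smooth-class item unconditionally. [cite: Stringari1995, §2.3 (20)–(23); ReedSimonIV1978, Thm. XIII.1] -/
theorem structureFactorFloor_smooth_of_puffFloor
    (hP : Theses.BECConjugateDomination.PuffFloor) :
    ∀ v : ℝ → ENNReal, IsRepulsiveFiniteRange v → (∀ r, v r ≠ ⊤) →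
      ContDiff ℝ 2 (fun x : Space => (v ‖x‖).toReal) →
      (∃ Cₑ : ℝ, ∀ x : Space, ‖iteratedFDeriv ℝ 2 (fun x : Space => (v ‖x‖).toReal) x‖
          ≤ Cₑ * Real.sqrt ((v ‖x‖).toReal)) →
      ∃ ρ₀ : ℝ, 0 < ρ₀ ∧ ∀ ρ : ℝ, 0 < ρ → ρ < ρ₀ → ∃ c ℓ : ℝ, 0 < c ∧ 0 < ℓ ∧
        ∀ᶠ n : ℕ in Filter.atTop, let L : ℝ := sideLength ρ (n + 1);
        ∃ δ : ENNReal, 0 < δ ∧ ∀ Ψ : PeriodicTrialState (n + 1) L,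
          periodicEnergy v Ψ ≤ periodicGroundStateEnergy v (n + 1) L + δ →
          (let S : (Fin 3 → ℤ) → ENNReal := fun m => ((n + 1 : ℕ) : ENNReal)⁻¹ *
              (∫⁻ X in cellN (n + 1) L, (‖∑ j : Fin (n + 1), cellWave L m (X j)‖₊ : ENNReal) ^ 2 *
                (‖Ψ.ψ X‖₊ : ENNReal) ^ 2);
            ∀ m : Fin 3 → ℤ, m ≠ 0 →
              ENNReal.ofReal (c * min (ℓ * ‖latticeVec L⁻¹ m‖) 1) ≤ S m) := by
  intro v hv hfin hC2 hedge
  obtain ⟨C, hC0, ρ₀, hρ₀, hPF⟩ := hP v hv hfin hC2 hedge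
  exact ⟨ρ₀, hρ₀, structureFactorFloor_smooth_of_exactFloor v hv hfin hC2 hedge hC0 hPF⟩

end Summit.AtomisticToContinuum.BoseEinsteinCondensation.Theorems

end
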